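import Mathlib.Algebra.MvPolynomial.PDeriv
import Mathlib.RingTheory.MvPolynomial.Homogeneous
import Mathlib.RingTheory.MvPolynomial.EulerIdentity
import Mathlib.Analysis.SpecialFunctions.Pow.Real
import HarnessLib

/-!
# The Fischer pairing on real polynomials and the Laplacian calculus of linear forms

For real polynomials `f, g ∈ ℝ[y₁, …, yₙ]` the **Fischer pairing** (apolar / Bombieri pairing)
is `B(f, g) = Σ_α α! f_α g_α` (`α! = Π_k α_k!`). It is symmetric, bilinear, positive
semidefinite (`B(f, f) = Σ α! f_α² ≥ 0`), and — its reason for existing — multiplication by a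
variable is adjoint to the corresponding partial derivative:
`B(X_k f, g) = B(f, ∂_k g)` (`fischer_X_mul`; coefficientwise `(β + e_k)! = β! (β_k + 1)`).
Equivalently `B(f, g) = (f(∂) g)(0)`; this is the standard device behind the decomposition
`𝒫_j = ℋ_j ⊕ |y|² 𝒫_{j-2}` of homogeneous polynomials into harmonics (Stein–Weiss IV.2,
Axler–Bourdon–Ramey Thm. 5.5), which we use in `Literature.Analysis.SpecialFunctions` to prove the
positive-definiteness of the zonal Gegenbauer kernels.

Contents (all PROVED, no named facts):

* `fischerWeight`, `fischer`, `fischerBilin` (the pairing as a bilinear map), `fischer_comm`,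
  `fischer_self_nonneg`, `fischer_X_mul` (adjointness);
* `innerForm x = Σ_k x_k X_k`, `sqNormPoly n = Σ_k X_k²`, `laplacian`, `dirDeriv x = Σ_k x_k ∂_k`;
  `fischer_innerForm_mul : B(L_x f, g) = B(f, D_x g)`, `fischer_sqNormPoly_mul : B(Q f, g) =
  B(f, Δ g)` and its iterate;
* the calculus: `∂_k L_x = x_k`, `∂_k Q = 2X_k`, `D_x L_{x'} = ⟨x, x'⟩`,
  `Δ(Q F) = Q ΔF + 4 Σ_k X_k ∂_k F + 2n F`, `Δ(L_x^m) = m(m-1)|x|² L_x^{m-2}`, Euler's identity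
  on `Q^i L_x^m` (Mathlib's `IsHomogeneous.sum_X_mul_pderiv`),
  `Δ(Q^i L_x^m) = 2i(2i+2m+n-2) Q^{i-1} L_x^m + m(m-1)|x|² Q^i L_x^{m-2}`,
  `Δ^i L_x^{m+2i} = ((m+2i)!/m!) |x|^{2i} L_x^m`, and `B(L_x^m, L_{x'}^m) = m! ⟨x, x'⟩^m`.

## References

* E. M. Stein, G. Weiss, *Introduction to Fourier Analysis on Euclidean Spaces*, Princeton
  1971, Ch. IV §2 (the inner product `P(D)\bar Q`). [folklore]
* S. Axler, P. Bourdon, W. Ramey, *Harmonic Function Theory*, 2nd ed., Springer GTM 137,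
  Ch. 5 (Thm. 5.5, the decomposition via `p(D)`). [folklore]
-/

noncomputable section

open _root_.MvPolynomial Finset
open scoped Nat

namespace Literature.RingTheory.MvPolynomial


variable {n : ℕ}

/-- The Fischer weight `α! = Π_k (α k)!`. [folklore] -/
def fischerWeight (α : Fin n →₀ ℕ) : ℝ := ∏ k : Fin n, ((α k)! : ℝ)

/-- `α! > 0`. [folklore] -/
theorem fischerWeight_pos (α : Fin n →₀ ℕ) : 0 < fischerWeight α :=
  Finset.prod_pos fun k _ => by exact_mod_cast Nat.factorial_pos _
/-- `0! = 1`. [folklore] -/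
theorem fischerWeight_zero : fischerWeight (0 : Fin n →₀ ℕ) = 1 := by simp [fischerWeight]

/-- `(α + e_k)! = α! (α_k + 1)`. [folklore] -/
theorem fischerWeight_add_single (α : Fin n →₀ ℕ) (k : Fin n) :
    fischerWeight (α + Finsupp.single k 1) = fischerWeight α * (α k + 1) := by
  unfold fischerWeight
  rw [← Finset.mul_prod_erase _ _ (Finset.mem_univ k),
    ← Finset.mul_prod_erase _ (fun i => ((α i)! : ℝ)) (Finset.mem_univ k)]
  have h1 : ∀ i ∈ (univ : Finset (Fin n)).erase k,
      ((((α + Finsupp.single k 1 : Fin n →₀ ℕ) i)! : ℕ) : ℝ) = ((α i)! : ℝ) := by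
    intro i hi
    rw [Finsupp.add_apply, Finsupp.single_eq_of_ne (Finset.ne_of_mem_erase hi), add_zero]
  rw [Finset.prod_congr rfl h1]
  simp [Nat.factorial_succ]
  ring

/-- The **Fischer pairing** `B(f, g) = Σ_α α! f_α g_α` on real polynomials in `n` variables
(Stein–Weiss IV.2). [folklore] -/
def fischer (f g : MvPolynomial (Fin n) ℝ) : ℝ :=
  ∑ α ∈ f.support, fischerWeight α * coeff α f * coeff α g

/-- The pairing may be summed over any finite set containing the support of the left factor.
[folklore] -/
theorem fischer_eq_sum_subset {f : MvPolynomial (Fin n) ℝ} (g : MvPolynomial (Fin n) ℝ)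
    {S : Finset (Fin n →₀ ℕ)} (hS : f.support ⊆ S) :
    fischer f g = ∑ α ∈ S, fischerWeight α * coeff α f * coeff α g := by
  apply Finset.sum_subset hS
  intro α _ hα
  rw [notMem_support_iff.1 hα]
  ring

/-- Symmetry `B(f, g) = B(g, f)`. [folklore] -/
theorem fischer_comm (f g : MvPolynomial (Fin n) ℝ) : fischer f g = fischer g f := by
  rw [fischer_eq_sum_subset g (Finset.subset_union_left (s₂ := g.support)),
    fischer_eq_sum_subset f (Finset.subset_union_right (s₁ := f.support))]
  exact Finset.sum_congr rfl fun α _ => by ring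

/-- Additivity in the right slot. [folklore] -/
theorem fischer_add_right (f g h : MvPolynomial (Fin n) ℝ) :
    fischer f (g + h) = fischer f g + fischer f h := by
  simp only [fischer, coeff_add, mul_add, Finset.sum_add_distrib]

/-- Homogeneity in the right slot. [folklore] -/
theorem fischer_smul_right (c : ℝ) (f g : MvPolynomial (Fin n) ℝ) :
    fischer f (c • g) = c * fischer f g := by
  simp only [fischer, coeff_smul, smul_eq_mul, Finset.mul_sum]
  exact Finset.sum_congr rfl fun α _ => by ring

/-- Additivity in the left slot. [folklore] -/
theorem fischer_add_left (f g h : MvPolynomial (Fin n) ℝ) :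
    fischer (f + g) h = fischer f h + fischer g h := by
  rw [fischer_comm, fischer_add_right, fischer_comm h, fischer_comm h]

/-- Homogeneity in the left slot. [folklore] -/
theorem fischer_smul_left (c : ℝ) (f g : MvPolynomial (Fin n) ℝ) :
    fischer (c • f) g = c * fischer f g := by
  rw [fischer_comm, fischer_smul_right, fischer_comm]

/-- The Fischer pairing as a bilinear map. [folklore] -/
def fischerBilin : MvPolynomial (Fin n) ℝ →ₗ[ℝ] MvPolynomial (Fin n) ℝ →ₗ[ℝ] ℝ :=
  LinearMap.mk₂ ℝ fischer fischer_add_left (fun c f g => by rw [fischer_smul_left, smul_eq_mul])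
    fischer_add_right (fun c f g => by rw [fischer_smul_right, smul_eq_mul])

/-- `fischerBilin f g = fischer f g`. [folklore] -/
@[simp] theorem fischerBilin_apply (f g : MvPolynomial (Fin n) ℝ) :
    fischerBilin f g = fischer f g := rfl

/-- Finite sums in the left slot. [folklore] -/
theorem fischer_sum_left {ι : Type*} (s : Finset ι) (f : ι → MvPolynomial (Fin n) ℝ)
    (g : MvPolynomial (Fin n) ℝ) : fischer (∑ i ∈ s, f i) g = ∑ i ∈ s, fischer (f i) g := by
  rw [← fischerBilin_apply, map_sum, LinearMap.sum_apply]
  rfl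

/-- Finite sums in the right slot. [folklore] -/
theorem fischer_sum_right {ι : Type*} (s : Finset ι) (f : MvPolynomial (Fin n) ℝ)
    (g : ι → MvPolynomial (Fin n) ℝ) : fischer f (∑ i ∈ s, g i) = ∑ i ∈ s, fischer f (g i) := by
  rw [← fischerBilin_apply, map_sum]
  rfl

/-- **Positivity**: `B(f, f) = Σ_α α! f_α² ≥ 0`. [folklore] -/
theorem fischer_self_nonneg (f : MvPolynomial (Fin n) ℝ) : 0 ≤ fischer f f :=
  Finset.sum_nonneg fun α _ => by
    have := fischerWeight_pos α
    nlinarith [mul_self_nonneg (coeff α f)]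

/-- `B(1, 1) = 1`. [folklore] -/
theorem fischer_one_one : fischer (1 : MvPolynomial (Fin n) ℝ) 1 = 1 := by
  classical
  rw [fischer_eq_sum_subset 1 (S := {0}) (by
    intro α hα
    rw [Finset.mem_singleton]
    by_contra h
    exact (mem_support_iff.1 hα) (by rw [coeff_one, if_neg (Ne.symm h)]))]
  simp [fischerWeight_zero]

/-- **Adjointness**: `B(X_k f, g) = B(f, ∂_k g)` (coefficientwise `(β + e_k)! = β!(β_k + 1)` and
Mathlib's `coeff_pderiv`). [folklore] -/
theorem fischer_X_mul (k : Fin n) (f g : MvPolynomial (Fin n) ℝ) :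
    fischer (X k * f) g = fischer f (pderiv k g) := by
  rw [fischer, support_X_mul, Finset.sum_map, fischer]
  refine Finset.sum_congr rfl fun β _ => ?_
  simp only [addLeftEmbedding_apply]
  rw [coeff_X_mul, coeff_pderiv, add_comm (Finsupp.single k 1) β, fischerWeight_add_single]
  ring

/-! ### Linear forms, the squared norm, the Laplacian -/

/-- The linear form `L_x = Σ_k x_k X_k`. [folklore] -/
def innerForm (x : Fin n → ℝ) : MvPolynomial (Fin n) ℝ := ∑ k, C (x k) * X k

/-- The squared norm `Q = Σ_k X_k²`. [folklore] -/
def sqNormPoly (n : ℕ) : MvPolynomial (Fin n) ℝ := ∑ k : Fin n, X k * X k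

/-- The Laplacian `Δ F = Σ_k ∂_k ∂_k F`. [folklore] -/
def laplacian (F : MvPolynomial (Fin n) ℝ) : MvPolynomial (Fin n) ℝ :=
  ∑ k, pderiv k (pderiv k F)

/-- The directional derivative `D_x = Σ_k x_k ∂_k`, a derivation. [folklore] -/
def dirDeriv (x : Fin n → ℝ) :
    Derivation ℝ (MvPolynomial (Fin n) ℝ) (MvPolynomial (Fin n) ℝ) :=
  ∑ k, x k • pderiv k

/-- Evaluation of a finite sum of derivations (dot-notation extension of Mathlib's `Derivation`,
declared with its absolute name). [folklore] -/
theorem Derivation.finset_sum_apply {ι R A M : Type*} [CommSemiring R] [CommSemiring A]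
    [AddCommMonoid M] [Algebra R A] [Module A M] [Module R M] (s : Finset ι)
    (D : ι → Derivation R A M) (a : A) : (∑ i ∈ s, D i) a = ∑ i ∈ s, D i a := by
  classical
  induction s using Finset.induction_on with
  | empty => simp
  | insert i s hi ih => rw [Finset.sum_insert hi, Finset.sum_insert hi, Derivation.add_apply, ih]

/-- `D_x F = Σ_k x_k ∂_k F`. [folklore] -/
theorem dirDeriv_apply (x : Fin n → ℝ) (F : MvPolynomial (Fin n) ℝ) :
    dirDeriv x F = ∑ k, x k • pderiv k F := by
  rw [dirDeriv, Derivation.finset_sum_apply]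
  simp [Derivation.smul_apply]

/-- `B(c f, g) = c B(f, g)`. [folklore] -/
theorem fischer_C_mul_left (c : ℝ) (f g : MvPolynomial (Fin n) ℝ) :
    fischer (C c * f) g = c * fischer f g := by
  rw [← smul_eq_C_mul, fischer_smul_left]

/-- `B(f, c g) = c B(f, g)`. [folklore] -/
theorem fischer_C_mul_right (c : ℝ) (f g : MvPolynomial (Fin n) ℝ) :
    fischer f (C c * g) = c * fischer f g := by
  rw [← smul_eq_C_mul, fischer_smul_right]

/-- `B(L_x f, g) = B(f, D_x g)`. [folklore] -/
theorem fischer_innerForm_mul (x : Fin n → ℝ) (f g : MvPolynomial (Fin n) ℝ) :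
    fischer (innerForm x * f) g = fischer f (dirDeriv x g) := by
  rw [innerForm, Finset.sum_mul, fischer_sum_left, dirDeriv_apply, fischer_sum_right]
  refine Finset.sum_congr rfl fun k _ => ?_
  rw [mul_assoc, fischer_C_mul_left, fischer_X_mul, fischer_smul_right]

/-- `B(Q f, g) = B(f, Δ g)`: multiplication by `|y|²` is adjoint to the Laplacian. [folklore] -/
theorem fischer_sqNormPoly_mul (f g : MvPolynomial (Fin n) ℝ) :
    fischer (sqNormPoly n * f) g = fischer f (laplacian g) := by
  rw [sqNormPoly, Finset.sum_mul, fischer_sum_left, laplacian, fischer_sum_right]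
  refine Finset.sum_congr rfl fun k _ => ?_
  rw [mul_assoc, fischer_X_mul, fischer_X_mul]

/-- `B(Q^i f, g) = B(f, Δ^i g)`. [folklore] -/
theorem fischer_sqNormPoly_pow_mul (i : ℕ) (f g : MvPolynomial (Fin n) ℝ) :
    fischer (sqNormPoly n ^ i * f) g = fischer f (laplacian^[i] g) := by
  induction i generalizing f g with
  | zero => simp
  | succ i ih =>
    rw [pow_succ, mul_assoc, ih (sqNormPoly n * f) g, fischer_sqNormPoly_mul,
      Function.iterate_succ_apply']

/-! ### Calculus of `L_x`, `Q`, `Δ`, `D_x` -/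

/-- `∂_k L_x = x_k`. [folklore] -/
theorem pderiv_innerForm (x : Fin n → ℝ) (k : Fin n) : pderiv k (innerForm x) = C (x k) := by
  classical
  rw [innerForm, map_sum]
  simp_rw [pderiv_C_mul, pderiv_X]
  simp [Pi.single_apply, Finset.sum_ite_eq']

/-- `∂_k Q = 2 X_k`. [folklore] -/
theorem pderiv_sqNormPoly (k : Fin n) : pderiv k (sqNormPoly n) = 2 * X k := by
  classical
  rw [sqNormPoly, map_sum]
  simp_rw [pderiv_mul, pderiv_X]
  simp only [Pi.single_apply, mul_ite, mul_one, mul_zero, ite_mul, one_mul, zero_mul]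
  rw [Finset.sum_add_distrib, Finset.sum_ite_eq']
  simp [two_mul]

/-- `D_x L_{x'} = ⟨x, x'⟩`. [folklore] -/
theorem dirDeriv_innerForm (x x' : Fin n → ℝ) :
    dirDeriv x (innerForm x') = C (∑ k, x k * x' k) := by
  rw [dirDeriv_apply, map_sum]
  simp_rw [pderiv_innerForm, smul_eq_C_mul, ← map_mul]

/-- `D_x L_{x'}^{m+1} = (m+1)⟨x, x'⟩ L_{x'}^m`. [folklore] -/
theorem dirDeriv_innerForm_pow (x x' : Fin n → ℝ) (m : ℕ) :
    dirDeriv x (innerForm x' ^ (m + 1)) =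
      C (((m : ℝ) + 1) * ∑ k, x k * x' k) * innerForm x' ^ m := by
  rw [Derivation.leibniz_pow, dirDeriv_innerForm, Nat.add_sub_cancel, smul_eq_mul, nsmul_eq_mul,
    map_mul]
  push_cast
  simp only [map_add, map_one, map_natCast]
  ring

/-- `Δ(Q F) = Q ΔF + 4 Σ_k X_k ∂_k F + 2n F`. [folklore] -/
theorem laplacian_sqNormPoly_mul (F : MvPolynomial (Fin n) ℝ) :
    laplacian (sqNormPoly n * F) =
      sqNormPoly n * laplacian F + 4 * ∑ k, X k * pderiv k F + (2 * n : ℝ) • F := by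
  have hk : ∀ k : Fin n, pderiv k (pderiv k (sqNormPoly n * F)) =
      sqNormPoly n * pderiv k (pderiv k F) + 4 * (X k * pderiv k F) + 2 * F := by
    intro k
    rw [pderiv_mul, pderiv_sqNormPoly, map_add, pderiv_mul, pderiv_mul, pderiv_mul,
      pderiv_X_self, pderiv_sqNormPoly]
    have h2 : pderiv k (2 : MvPolynomial (Fin n) ℝ) = 0 := by
      rw [show (2 : MvPolynomial (Fin n) ℝ) = C 2 from (map_ofNat C 2).symm, pderiv_C]
    rw [h2]
    ring
  rw [laplacian]
  simp_rw [hk]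
  rw [Finset.sum_add_distrib, Finset.sum_add_distrib, ← Finset.mul_sum, ← Finset.mul_sum,
    Finset.sum_const, Finset.card_univ, Fintype.card_fin, laplacian, smul_eq_C_mul]
  rw [nsmul_eq_mul, map_mul]
  simp only [map_natCast, map_ofNat]
  ring

/-- `Δ(L_x^m) = m(m-1)|x|² L_x^{m-2}`. [folklore] -/
theorem laplacian_innerForm_pow (x : Fin n → ℝ) (m : ℕ) :
    laplacian (innerForm x ^ m) =
      C (((m * (m - 1) : ℕ) : ℝ) * ∑ k, x k ^ 2) * innerForm x ^ (m - 2) := by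
  have hk : ∀ k : Fin n, pderiv k (pderiv k (innerForm x ^ m)) =
      C (((m * (m - 1) : ℕ) : ℝ) * x k ^ 2) * innerForm x ^ (m - 2) := by
    intro k
    rw [pderiv_pow, pderiv_innerForm, pderiv_mul, pderiv_mul, pderiv_C, pderiv_pow, pderiv_innerForm,
      mul_zero, add_zero, show m - 1 - 1 = m - 2 by omega]
    have hm : pderiv k (m : MvPolynomial (Fin n) ℝ) = 0 := by
      rw [show (m : MvPolynomial (Fin n) ℝ) = C (m : ℝ) by simp, pderiv_C]
    rw [hm, zero_mul, zero_add]
    rw [show ((m - 1 : ℕ) : MvPolynomial (Fin n) ℝ) = C ((m - 1 : ℕ) : ℝ) by simp,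
      show (m : MvPolynomial (Fin n) ℝ) = C (m : ℝ) by simp]
    simp only [Nat.cast_mul]
    rw [show ∀ a b c : ℝ, C a * (C b * innerForm x ^ (m - 2) * C c) * C c =
      C (a * b * c * c) * innerForm x ^ (m - 2) from fun a b c => by simp only [map_mul]; ring]
    congr 2
    ring
  rw [laplacian]
  simp_rw [hk]
  rw [← Finset.sum_mul, ← map_sum, ← Finset.mul_sum]

/-- `Q` is homogeneous of degree `2`. [folklore] -/
theorem isHomogeneous_sqNormPoly : (sqNormPoly n).IsHomogeneous 2 :=
  IsHomogeneous.sum _ _ 2 fun k _ => (isHomogeneous_X ℝ k).mul (isHomogeneous_X ℝ k)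

/-- `L_x` is homogeneous of degree `1`. [folklore] -/
theorem isHomogeneous_innerForm (x : Fin n → ℝ) : (innerForm x).IsHomogeneous 1 :=
  IsHomogeneous.sum _ _ 1 fun k _ => isHomogeneous_C_mul_X (x k) k

/-- Euler: `Σ_k X_k ∂_k (Q^i L^m) = (2i + m) (Q^i L^m)` (Mathlib's Euler identity). [folklore] -/
theorem euler_sqNormPoly_pow_mul_innerForm_pow (x : Fin n → ℝ) (i m : ℕ) :
    ∑ k, X k * pderiv k (sqNormPoly n ^ i * innerForm x ^ m) =
      (2 * i + m) • (sqNormPoly n ^ i * innerForm x ^ m) := by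
  have h := (isHomogeneous_sqNormPoly.pow i).mul ((isHomogeneous_innerForm x).pow m)
  rw [one_mul] at h
  exact h.sum_X_mul_pderiv

/-- **`Δ(Q^i L^m) = 2i(2i + 2m + n - 2) Q^{i-1} L^m + m(m-1)|x|² Q^i L^{m-2}`** (junk-free: the
coefficients vanish exactly when the `ℕ`-subtracted exponents would be wrong). [folklore] -/
theorem laplacian_sqNormPoly_pow_mul_innerForm_pow (x : Fin n → ℝ) (i m : ℕ) :
    laplacian (sqNormPoly n ^ i * innerForm x ^ m) =
      C (2 * i * (2 * i + 2 * m + n - 2 : ℝ)) * (sqNormPoly n ^ (i - 1) * innerForm x ^ m) +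
        C (((m * (m - 1) : ℕ) : ℝ) * ∑ k, x k ^ 2) * (sqNormPoly n ^ i * innerForm x ^ (m - 2)) := by
  induction i with
  | zero => simp [laplacian_innerForm_pow]
  | succ i ih =>
    rw [pow_succ', mul_assoc, laplacian_sqNormPoly_mul, ih, euler_sqNormPoly_pow_mul_innerForm_pow,
      Nat.add_sub_cancel]
    have hQ : sqNormPoly n * (C (2 * i * (2 * i + 2 * m + n - 2 : ℝ)) *
        (sqNormPoly n ^ (i - 1) * innerForm x ^ m)) =
        C (2 * i * (2 * i + 2 * m + n - 2 : ℝ)) * (sqNormPoly n ^ i * innerForm x ^ m) := by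
      rcases i with _ | i
      · simp
      · rw [Nat.add_sub_cancel, pow_succ]
        ring
    rw [mul_add, hQ, nsmul_eq_mul, smul_eq_C_mul, show ((2 * i + m : ℕ) : MvPolynomial (Fin n) ℝ)
      = C ((2 * i + m : ℕ) : ℝ) from (map_natCast C _).symm,
      show (4 : MvPolynomial (Fin n) ℝ) = C 4 from (map_ofNat C 4).symm]
    simp only [map_mul, map_add, map_sub, map_natCast, map_ofNat, map_one, Nat.cast_add,
      Nat.cast_mul, Nat.cast_ofNat, Nat.cast_one]
    ring

/-- `Δ(c F) = c ΔF`. [folklore] -/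
theorem laplacian_C_mul (c : ℝ) (F : MvPolynomial (Fin n) ℝ) :
    laplacian (C c * F) = C c * laplacian F := by
  simp [laplacian, Finset.mul_sum]

/-- `Δ^i(c F) = c Δ^i F`. [folklore] -/
theorem iterate_laplacian_C_mul (i : ℕ) (c : ℝ) (F : MvPolynomial (Fin n) ℝ) :
    laplacian^[i] (C c * F) = C c * laplacian^[i] F := by
  induction i generalizing F with
  | zero => rfl
  | succ i ih => rw [Function.iterate_succ_apply, Function.iterate_succ_apply, laplacian_C_mul, ih]

/-- `Δ^i 0 = 0`. [folklore] -/
theorem iterate_laplacian_zero (i : ℕ) : laplacian^[i] (0 : MvPolynomial (Fin n) ℝ) = 0 := by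
  induction i with
  | zero => rfl
  | succ i ih => rw [Function.iterate_succ_apply', ih]; simp [laplacian]

/-- `Δ^i (L_x^{m+2i}) = ((m+2i)!/m!) |x|^{2i} L_x^m`. [folklore] -/
theorem iterate_laplacian_innerForm_pow (x : Fin n → ℝ) (i m : ℕ) :
    laplacian^[i] (innerForm x ^ (m + 2 * i)) =
      C ((((m + 2 * i)! : ℕ) : ℝ) / m ! * (∑ k, x k ^ 2) ^ i) * innerForm x ^ m := by
  induction i with
  | zero =>
    have hm : (m ! : ℝ) ≠ 0 := by exact_mod_cast Nat.factorial_ne_zero m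
    simp [div_self hm]
  | succ i ih =>
    rw [show m + 2 * (i + 1) = (m + 2 * i) + 2 by ring, Function.iterate_succ_apply,
      laplacian_innerForm_pow, show m + 2 * i + 2 - 2 = m + 2 * i by omega,
      iterate_laplacian_C_mul, ih, ← mul_assoc, ← map_mul]
    congr 2
    have hm : (m ! : ℝ) ≠ 0 := by exact_mod_cast Nat.factorial_ne_zero m
    rw [show m + 2 * i + 2 - 1 = m + 2 * i + 1 by omega, Nat.factorial_succ, Nat.factorial_succ]
    field_simp
    push_cast
    ring

/-- **`B(L_x^m, L_{x'}^m) = m! ⟨x, x'⟩^m`** (the reproducing property of `⟨x, ·⟩^m/m!`).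
[folklore] -/
theorem fischer_innerForm_pow (x x' : Fin n → ℝ) (m : ℕ) :
    fischer (innerForm x ^ m) (innerForm x' ^ m) = m ! * (∑ k, x k * x' k) ^ m := by
  induction m with
  | zero => simp [fischer_one_one]
  | succ m ih =>
    rw [pow_succ', fischer_innerForm_mul, dirDeriv_innerForm_pow, fischer_C_mul_right, ih]
    push_cast [Nat.factorial_succ]
    ring

end Literature.RingTheory.MvPolynomial

end
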